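import Literature.MathematicalPhysics.QuantumFieldTheory.Balaban1983to89.Beta.EntrywiseVolumeLimit

/-!
# `BalabanUV.Beta.D1BFx.FibredPeriodisation` — road «BF-x», binder row D1, slot (K), debt X₁ (`Δ_a·Ga = δ` on `ℤ⁴` for `Ga = Kinf`), brick
# **Q1 «FIBRED PERIODISATION»** of `HOME/b2b-balaban-beta-d1-p2/X1-SPEC.md` v1 §1: an4's two-variable periodisation `periodise₂` and its block-periodic
# Lemma 2.2.2 (`Beta/EntrywiseVolumeLimit`, IN TREE) carried FIBRE BY FIBRE to kernels on `ℤ^d × (finite fibre)` — the index of an5's vector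
# propagator `Kinf n a : (ℤ^d × Fin d) → (ℤ^d × Fin d) → ℝ` and of the torus matrices `Matrix (Tor T × Fin d) (Tor T × Fin d)` of `B5DeltaA169.DeltaA` —
# with the composition bookkeeping on `ℤ^d`, the transpose rule, the fibred finite-range dictionary, and THE UNFOLD-AND-REGROUP LEMMA brick Q4 consumes

WHY (X1-SPEC v1 §1 «THE PERIODISATION ROAD»).  Per even cubic volume `DeltaA_t·calG_t = 1` entrywise (`B5DeltaA169.DeltaA_mul_calG`); bricks Q2∕Q3c
identify `DeltaA_t∕n²` with the periodisation of the `ℤ⁴` kernel `Δ^∞` of `½·curvAdj∘curv + dz∘R∘codiff₁ + (a∕n⁸)·𝒬ᵀ𝒬`; Q4 unfolds the periodisation,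
regroups, and lets `t → ∞` along `calG_re_tendsto_Kinf` (Tannery).  All SCALAR machinery is an4's; the vector propagator and the form operators are
FIBRED (`Fin d` components) and `dz∘P∘codiff₁` mixes fibres (scalar factors = `Kernel₂ d`, composed per fibre pair).  THIS FILE is that carrier layer, generic in the fibre types `α β γ`.
CONTENT (all [folklore]∕[our object]; every `d`, torus `Site d s = (ℤ∕s)^d`, `s ≥ 1`): §1 fibred kernels `FKer`, fibre reader `Kfib`, `kdeltaF`,
`compF`; §1b scalar composition bookkeeping NOT in an4's file (`summable_uncurry_mul`, `summable_compKer`, `summable_abs_compKer`,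
`rowBound_compKer`, `isPeriodic₂_compKer`); §2 **`periodiseF`** (= `periodise₂` of each fibre) and its calculus (`δ̂ = 1`, sums, bounds); §3 **product rule
`periodiseF_compF(_matrix)`**, **fibred Lemma 2.2.2 `lemma222F`**, `eq_periodiseF_of_mul_eq_one(')`; §4 **UNFOLD-AND-REGROUP** `sum_periodise₂_mul(_of_rep)` ∕
`sum_periodiseF_mul(_of_rep)` (`Σ_{(z̄,b)} K̂((x̄,a),(z̄,b))·g(z̄,b) = Σ_b Σ'_{w ∈ ℤ^d} K((x,a),(w,b))·g(w̄,b)`) + `tsum_prod_fintype_right`; §5 transpose rules;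
§6 fibred finite-range dictionary `periodiseF_siteOf_eq` (brick Q2's tool); §7 non-vacuity `compF δ δ = δ`.

HONEST FRAMING (cell contract, verbatim): «discharging `BetaPertH` makes Bałaban's UV stability UNCONDITIONAL — a real constructive-QFT
result; it is NOT the continuum limit and NOT the Clay problem.»  HONEST DEPENDENCY (verbatim): «continuum YM on T⁴ ⇐ BetaPertH ∧ nine
spine estimates (0/9 proved); BetaPertH ⇐ (D1) ∧ (D4) ∧ CAP+tail; G-an2-4 gates asym, D1 and NE2/3/4.»  [folklore] absolutely convergent lattice
bookkeeping over an4's LANDED `periodise₂`∕`periodise₂_compKer`∕`periodise₂_kdelta`∕`periodise₂_siteOf_eq`∕`tsum_eq_sum_tsum_imageShift` (USED BY NAME,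
nothing re-proved); 0 analytic content about `Kinf`; no `Prop` is minted, nothing is cited, no wall binder is instantiated; 0 sorry.  NOT D1, NOT
BetaPertH, NOT summit progress.  ABSOLUTE RULE (cell, verbatim): «No internally-minted statement may enter as a cited fact. Every hypothesis is
either kernel-proved in this package or a verbatim quotation of a PUBLISHED theorem with page reference. The manuscript(s) under audit are NOT
citable for their own disputed steps — they are the thing under adjudication; programme-internal (2001/route/tribunal) claims are never citable.»
Provenance: D1 formalisation swarm, unit `b2b-balaban-beta-d1-formalise-leaf-03` (gen 7), claim «X1-Q1», 2026-08-20.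
-/

noncomputable section

namespace Summit.QuantumFields.BalabanUV.Beta.D1BFx.FibredPeriodisation

open Literature.MathematicalPhysics.QuantumFieldTheory.Balaban1983to89
open Literature.MathematicalPhysics.QuantumFieldTheory.Balaban1983to89.Beta
open scoped BigOperators

variable {d : ℕ} {α β γ : Type*}

/-! ## §1 Fibred kernels on `ℤ^d`, fibre readers, fibred composition -/

/-- [our object] **FIBRED KERNELS**: operators on `ℤ^d × α → ℝ` by their entries `K (x,a) (y,b)` (fibre second, as in `Kinf`). -/
abbrev FKer (d : ℕ) (α β : Type*) : Type _ := ((Fin d → ℤ) × α) → ((Fin d → ℤ) × β) → ℝ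

/-- [our object] THE FIBRE READER: the scalar `ℤ^d` kernel `(x, y) ↦ K (x,a) (y,b)` of the fibre pair `(a, b)`. -/
def Kfib (K : FKer d α β) (a : α) (b : β) : Kernel₂ d := fun x y => K (x, a) (y, b)

/-- [our object] Unfolding of `Kfib`. -/
@[simp] theorem Kfib_apply (K : FKer d α β) (a : α) (b : β) (x y : Fin d → ℤ) : Kfib K a b x y = K (x, a) (y, b) := rfl

/-- [our object] The fibred Kronecker kernel `δ((x,a),(y,b))`. -/
def kdeltaF [DecidableEq α] : FKer d α α := fun i j => if i = j then 1 else 0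

/-- [our object] **FIBRED COMPOSITION** `(K ∘ L)((x,a),(z,c)) := Σ_b Σ'_y K((x,a),(y,b))·L((y,b),(z,c))` (fibre sum outside). -/
def compF [Fintype β] (K : FKer d α β) (L : FKer d β γ) : FKer d α γ :=
  fun i j => ∑ b, ∑' y : Fin d → ℤ, K i (y, b) * L (y, b) j

/-- [our object] `compF` is the fibre sum of an4's scalar compositions `compKer` of the fibre kernels. -/
theorem compF_apply [Fintype β] (K : FKer d α β) (L : FKer d β γ) (x z : Fin d → ℤ) (a : α) (c : γ) :
    compF K L (x, a) (z, c) = ∑ b, compKer (Kfib K a b) (Kfib L b c) x z := rfl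

/-! ## §1b Scalar composition bookkeeping (rows of `T ∘ S`; periodicity and row bound of `T ∘ S`) -/

section ScalarComp
variable {T S : Kernel₂ d} {A B : ℝ} {x : Fin d → ℤ}

/-- [folklore] `(y, z) ↦ |T(x,y)|·|S(y,z)|` is summable from an absolutely summable `T`-row and a row bound on `S` (Tonelli). -/
theorem summable_abs_prod_mul (hT : Summable fun y => |T x y|) (hSB : RowBound S B) :
    Summable fun p : (Fin d → ℤ) × (Fin d → ℤ) => |T x p.1| * |S p.1 p.2| := by
  have hnn : 0 ≤ fun p : (Fin d → ℤ) × (Fin d → ℤ) => |T x p.1| * |S p.1 p.2| :=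
    fun p => mul_nonneg (abs_nonneg _) (abs_nonneg _)
  refine (summable_prod_of_nonneg hnn).mpr ⟨fun y => ?_, ?_⟩
  · show Summable fun z => |T x y| * |S y z|
    exact (hSB y).1.mul_left _
  · refine Summable.of_nonneg_of_le (f := fun y => |T x y| * B) (fun y => tsum_nonneg fun z => hnn (y, z))
      (fun y => ?_) (hT.mul_right B)
    show ∑' z, |T x y| * |S y z| ≤ |T x y| * B
    rw [tsum_mul_left]
    exact mul_le_mul_of_nonneg_left (hSB y).2 (abs_nonneg _)

/-- [folklore] The same family in `Function.uncurry` form (the shape `Summable.tsum_comm`∕`.prod` consume). -/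
theorem summable_abs_uncurry_mul (hT : Summable fun y => |T x y|) (hSB : RowBound S B) :
    Summable (Function.uncurry fun y z : Fin d → ℤ => |T x y| * |S y z|) :=
  summable_abs_prod_mul hT hSB

/-- [folklore] … hence the signed double family `(y, z) ↦ T(x,y)·S(y,z)` is summable. -/
theorem summable_uncurry_mul (hT : Summable fun y => |T x y|) (hSB : RowBound S B) :
    Summable (Function.uncurry fun y z : Fin d → ℤ => T x y * S y z) := by
  have h3 : Summable fun p : (Fin d → ℤ) × (Fin d → ℤ) => |T x p.1 * S p.1 p.2| := by
    simpa only [abs_mul] using summable_abs_prod_mul hT hSB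
  exact h3.of_abs

/-- [folklore] The `x`-row of `T ∘ S` is summable. -/
theorem summable_compKer (hT : Summable fun y => |T x y|) (hSB : RowBound S B) : Summable (compKer T S x) :=
  (summable_uncurry_mul hT hSB).prod_symm.prod

/-- [folklore] The `x`-row of `T ∘ S` is absolutely summable, with `Σ_z |(T∘S)(x,z)| ≤ (Σ_y |T(x,y)|)·B`. -/
theorem summable_abs_compKer (hT : Summable fun y => |T x y|) (hSB : RowBound S B) :
    (Summable fun z => |compKer T S x z|) ∧ ∑' z, |compKer T S x z| ≤ (∑' y, |T x y|) * B := by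
  have h2 := summable_abs_uncurry_mul hT hSB
  have hcol : Summable fun z => ∑' y, |T x y| * |S y z| := h2.prod_symm.prod
  have hmaj : ∀ z, |compKer T S x z| ≤ ∑' y, |T x y| * |S y z| := fun z => by
    have hz : Summable fun y => |T x y| * |S y z| := h2.prod_symm.prod_factor z
    have e : (fun y => ‖T x y * S y z‖) = fun y => |T x y| * |S y z| := funext fun y => by
      rw [Real.norm_eq_abs, abs_mul]
    have h := norm_tsum_le_tsum_norm (f := fun y => T x y * S y z) (by rw [e]; exact hz)
    rw [Real.norm_eq_abs, e] at h
    exact h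
  have hs : Summable fun z => |compKer T S x z| := Summable.of_nonneg_of_le (fun z => abs_nonneg _) hmaj hcol
  refine ⟨hs, (Summable.tsum_le_tsum hmaj hs hcol).trans ?_⟩
  have hrow : Summable fun y => |T x y| * ∑' z, |S y z| :=
    h2.prod.congr fun y => by show ∑' z, |T x y| * |S y z| = _; exact tsum_mul_left
  calc ∑' z, ∑' y, |T x y| * |S y z| = ∑' y, ∑' z, |T x y| * |S y z| := h2.tsum_comm
    _ = ∑' y, |T x y| * ∑' z, |S y z| := tsum_congr fun y => tsum_mul_left
    _ ≤ ∑' y, |T x y| * B :=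
        Summable.tsum_le_tsum (fun y => mul_le_mul_of_nonneg_left (hSB y).2 (abs_nonneg _)) hrow (hT.mul_right B)
    _ = (∑' y, |T x y|) * B := tsum_mul_right

/-- [folklore] **ROW BOUND OF A COMPOSITION**: `‖T ∘ S‖_{ℓ^∞→ℓ^∞} ≤ A·B`. -/
theorem rowBound_compKer (hTA : RowBound T A) (hSB : RowBound S B) : RowBound (compKer T S) (A * B) := fun x =>
  ⟨(summable_abs_compKer (hTA x).1 hSB).1,
    (summable_abs_compKer (hTA x).1 hSB).2.trans (mul_le_mul_of_nonneg_right (hTA x).2 hSB.nonneg)⟩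

/-- [folklore] **A COMPOSITION OF JOINTLY `s`-PERIODIC KERNELS IS JOINTLY `s`-PERIODIC** (re-index the middle variable; no summability needed). -/
theorem isPeriodic₂_compKer {s : ℕ} (hT : IsPeriodic₂ s T) (hS : IsPeriodic₂ s S) : IsPeriodic₂ s (compKer T S) := by
  intro x z n
  simp only [compKer]
  calc ∑' y, T (imageShift s x n) y * S y (imageShift s z n)
      = ∑' y, T x (imageShiftEquiv s (-n) y) * S (imageShiftEquiv s (-n) y) z :=
        tsum_congr fun y => by rw [imageShiftEquiv_apply, hT.shift_left, hS.shift_right]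
    _ = ∑' y, T x y * S y z := (imageShiftEquiv s (-n)).tsum_eq (fun y => T x y * S y z)

end ScalarComp

/-! ## §2 Fibrewise periodisation -/

section Periodise
variable {s : ℕ} [NeZero s]

/-- [our object] **FIBREWISE PERIODISATION** `K̂((x̄,a),(ȳ,b)) := Σ_n K((x̂,a),(ŷ + s·n, b))` = an4's `periodise₂` of `Kfib K a b`. -/
def periodiseF (s : ℕ) [NeZero s] (K : FKer d α β) : (Site d s × α) → (Site d s × β) → ℝ :=
  fun i j => periodise₂ s (Kfib K i.2 j.2) i.1 j.1

/-- [our object] Unfolding of `periodiseF`. -/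
@[simp] theorem periodiseF_apply (K : FKer d α β) (x y : Site d s) (a : α) (b : β) :
    periodiseF s K (x, a) (y, b) = periodise₂ s (Kfib K a b) x y := rfl

/-- [folklore] REPRESENTATIVE INDEPENDENCE: `periodiseF` computed with any representatives of a jointly periodic fibre. -/
theorem periodiseF_eq_tsum_of_rep {K : FKer d α β} {a : α} {b : β} (hper : IsPeriodic₂ s (Kfib K a b))
    (hrow : ∀ x, Summable (Kfib K a b x)) {x y : Site d s} {r q : Fin d → ℤ} (hr : siteOf d s r = x) (hq : siteOf d s q = y) :
    periodiseF s K (x, a) (y, b) = ∑' n, K (r, a) (imageShift s q n, b) :=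
  (hasSum_periodise₂_of_rep hper hrow hr hq).tsum_eq.symm

/-- [folklore] The periodisation of the zero kernel vanishes. -/
theorem periodise₂_zero (x y : Site d s) : periodise₂ s (fun _ _ => (0 : ℝ) : Kernel₂ d) x y = 0 := by
  simp [periodise₂]

/-- [our object] Diagonal fibres of `kdeltaF` are `kdelta`. -/
theorem Kfib_kdeltaF_self [DecidableEq α] (a : α) : Kfib (kdeltaF (d := d)) a a = kdelta := by
  funext x y
  simp [kdeltaF, kdelta]

/-- [our object] Off-diagonal fibres of `kdeltaF` vanish. -/
theorem Kfib_kdeltaF_of_ne [DecidableEq α] {a b : α} (h : a ≠ b) : Kfib (kdeltaF (d := d)) a b = fun _ _ => 0 := by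
  funext x y
  simp [kdeltaF, h]

/-- [folklore] **`δ̂ = 1`**: the periodisation of the fibred Kronecker kernel is the Kronecker kernel of the torus index. -/
theorem periodiseF_kdeltaF [DecidableEq α] (i j : Site d s × α) :
    periodiseF s (kdeltaF (d := d)) i j = if i = j then 1 else 0 := by
  obtain ⟨x, a⟩ := i
  obtain ⟨y, b⟩ := j
  rw [periodiseF_apply]
  by_cases hab : a = b
  · subst hab
    rw [Kfib_kdeltaF_self, periodise₂_kdelta]
    simp
  · rw [Kfib_kdeltaF_of_ne hab, periodise₂_zero]
    simp [hab]

/-- [folklore] Matrix form of `δ̂ = 1`. -/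
theorem periodiseF_kdeltaF_matrix [DecidableEq α] :
    Matrix.of (periodiseF s (kdeltaF (d := d))) = (1 : Matrix (Site d s × α) (Site d s × α) ℝ) := by
  ext i j
  rw [Matrix.of_apply, periodiseF_kdeltaF, Matrix.one_apply]

/-- [folklore] Additivity. -/
theorem periodiseF_add {K L : FKer d α β} (hK : ∀ a b x, Summable (Kfib K a b x)) (hL : ∀ a b x, Summable (Kfib L a b x))
    (i : Site d s × α) (j : Site d s × β) : periodiseF s (K + L) i j = periodiseF s K i j + periodiseF s L i j :=
  periodise₂_add (hK i.2 j.2) (hL i.2 j.2) i.1 j.1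

/-- [folklore] Homogeneity. -/
theorem periodiseF_const_mul (c : ℝ) (K : FKer d α β) (i : Site d s × α) (j : Site d s × β) :
    periodiseF s (fun i' j' => c * K i' j') i j = c * periodiseF s K i j :=
  periodise₂_const_mul c (Kfib K i.2 j.2) i.1 j.1

/-- [folklore] Finite sums of kernels periodise termwise (scalar). -/
theorem periodise₂_finset_sum {ι : Type*} (S : Finset ι) (K : ι → Kernel₂ d) (hK : ∀ t ∈ S, ∀ x, Summable (K t x))
    (x y : Site d s) : periodise₂ s (fun p q => ∑ t ∈ S, K t p q) x y = ∑ t ∈ S, periodise₂ s (K t) x y := by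
  unfold periodise₂
  exact Summable.tsum_finsetSum fun t ht => summable_row_imageShift (hK t ht) _ _

/-- [folklore] Entries of the periodisation are bounded by the row bound of the fibre. -/
theorem abs_periodiseF_le {K : FKer d α β} {B : ℝ} {a : α} {b : β} (hKB : RowBound (Kfib K a b) B) (x y : Site d s) :
    |periodiseF s K (x, a) (y, b)| ≤ B :=
  abs_periodise₂_le hKB x y

/-! ## §3 The fibred product rule and the fibred Lemma 2.2.2 -/

/-- [folklore] Matrix form of an4's scalar product rule: `(T ∘ S)^ = T̂ · Ŝ`. -/
theorem periodise₂_compKer_matrix {T S : Kernel₂ d} {B : ℝ} (hT : ∀ x, Summable fun y => |T x y|) (hS : IsPeriodic₂ s S)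
    (hSB : RowBound S B) : Matrix.of (periodise₂ s (compKer T S)) = Matrix.of (periodise₂ s T) * Matrix.of (periodise₂ s S) := by
  ext x z
  rw [Matrix.mul_apply]
  exact periodise₂_compKer hT hS hSB x z

/-- [folklore] **FIBRED PRODUCT RULE** `(K ∘ L)^ = K̂·L̂` entrywise over `Site d s × β` (fibres of `K` absolutely summable rows; fibres of
`L` jointly `s`-periodic with a common row bound). -/
theorem periodiseF_compF [Fintype β] {K : FKer d α β} {L : FKer d β γ} {B : ℝ}
    (hK : ∀ a b x, Summable fun y => |Kfib K a b x y|) (hL : ∀ b c, IsPeriodic₂ s (Kfib L b c))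
    (hLB : ∀ b c, RowBound (Kfib L b c) B) (i : Site d s × α) (k : Site d s × γ) :
    periodiseF s (compF K L) i k = ∑ j : Site d s × β, periodiseF s K i j * periodiseF s L j k := by
  obtain ⟨x, a⟩ := i
  obtain ⟨z, c⟩ := k
  rw [Fintype.sum_prod_type, Finset.sum_comm]
  simp only [periodiseF_apply]
  rw [show Kfib (compF K L) a c = fun x z => ∑ b ∈ Finset.univ, compKer (Kfib K a b) (Kfib L b c) x z from rfl,
    periodise₂_finset_sum _ _ (fun b _ x' => summable_compKer (hK a b x') (hLB b c))]
  exact Finset.sum_congr rfl fun b _ => periodise₂_compKer (hK a b) (hL b c) (hLB b c) x z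

/-- [folklore] Matrix form of the fibred product rule: `(K ∘ L)^ = K̂ · L̂` over the index `Site d s × β`. -/
theorem periodiseF_compF_matrix [Fintype β] {K : FKer d α β} {L : FKer d β γ} {B : ℝ}
    (hK : ∀ a b x, Summable fun y => |Kfib K a b x y|) (hL : ∀ b c, IsPeriodic₂ s (Kfib L b c))
    (hLB : ∀ b c, RowBound (Kfib L b c) B) :
    Matrix.of (periodiseF s (compF K L)) = Matrix.of (periodiseF s K) * Matrix.of (periodiseF s L) := by
  ext i k
  rw [Matrix.mul_apply]
  exact periodiseF_compF hK hL hLB i k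

/-- [folklore] **LEMMA 2.2.2, FIBRED BLOCK-PERIODIC VERSION**: `compF T S = kdeltaF` on `ℤ^d × α` (fibres of `T` absolutely summable rows,
fibres of `S` jointly `s`-periodic with a common row bound) ⟹ `T̂Ŝ = 1` AND `ŜT̂ = 1` on the torus index `Site d s × α`. -/
theorem lemma222F [Fintype α] [DecidableEq α] {T S : FKer d α α} {B : ℝ}
    (hT : ∀ a b x, Summable fun y => |Kfib T a b x y|) (hS : ∀ a b, IsPeriodic₂ s (Kfib S a b))
    (hSB : ∀ a b, RowBound (Kfib S a b) B) (hTS : compF T S = kdeltaF) :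
    Matrix.of (periodiseF s T) * Matrix.of (periodiseF s S) = 1 ∧
      Matrix.of (periodiseF s S) * Matrix.of (periodiseF s T) = 1 := by
  have h1 : Matrix.of (periodiseF s T) * Matrix.of (periodiseF s S) = 1 := by
    rw [← periodiseF_compF_matrix hT hS hSB, hTS, periodiseF_kdeltaF_matrix]
  exact ⟨h1, mul_eq_one_comm.mp h1⟩

/-- [folklore] **IDENTIFICATION OF A TORUS INVERSE**: under the hypotheses of `lemma222F`, ANY right inverse `G` of `T̂` is `Ŝ`. -/
theorem eq_periodiseF_of_mul_eq_one [Fintype α] [DecidableEq α] {T S : FKer d α α} {B : ℝ}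
    (hT : ∀ a b x, Summable fun y => |Kfib T a b x y|) (hS : ∀ a b, IsPeriodic₂ s (Kfib S a b))
    (hSB : ∀ a b, RowBound (Kfib S a b) B) (hTS : compF T S = kdeltaF)
    {G : Matrix (Site d s × α) (Site d s × α) ℝ} (hG : Matrix.of (periodiseF s T) * G = 1) :
    G = Matrix.of (periodiseF s S) := by
  have h2 := (lemma222F hT hS hSB hTS).2
  calc G = (Matrix.of (periodiseF s S) * Matrix.of (periodiseF s T)) * G := by rw [h2, Matrix.one_mul]
    _ = Matrix.of (periodiseF s S) := by rw [Matrix.mul_assoc, hG, Matrix.mul_one]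

/-- [folklore] The same for a left inverse. -/
theorem eq_periodiseF_of_mul_eq_one' [Fintype α] [DecidableEq α] {T S : FKer d α α} {B : ℝ}
    (hT : ∀ a b x, Summable fun y => |Kfib T a b x y|) (hS : ∀ a b, IsPeriodic₂ s (Kfib S a b))
    (hSB : ∀ a b, RowBound (Kfib S a b) B) (hTS : compF T S = kdeltaF)
    {G : Matrix (Site d s × α) (Site d s × α) ℝ} (hG : G * Matrix.of (periodiseF s T) = 1) :
    G = Matrix.of (periodiseF s S) := by
  have h1 := (lemma222F hT hS hSB hTS).1
  calc G = G * (Matrix.of (periodiseF s T) * Matrix.of (periodiseF s S)) := by rw [h1, Matrix.mul_one]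
    _ = Matrix.of (periodiseF s S) := by rw [← Matrix.mul_assoc, hG, Matrix.one_mul]

/-! ## §4 Unfold-and-regroup: torus sums against a periodised kernel are `ℤ^d` sums against the kernel -/

/-- [folklore] An absolutely summable row against a torus function read on `ℤ^d` is summable. -/
theorem summable_row_mul_torusFun {T : Kernel₂ d} {x : Fin d → ℤ} (hT : Summable fun y => |T x y|) (g : Site d s → ℝ) :
    Summable fun w => T x w * g (siteOf d s w) := by
  refine Summable.of_norm_bounded (hT.mul_right (∑ z, |g z|)) fun w => ?_
  rw [Real.norm_eq_abs, abs_mul]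
  exact mul_le_mul_of_nonneg_left
    (Finset.single_le_sum (f := fun z => |g z|) (fun z _ => abs_nonneg (g z)) (Finset.mem_univ _)) (abs_nonneg _)

/-- [folklore] **UNFOLD-AND-REGROUP (scalar, window representative)**: `Σ_{z ∈ torus} T̂(x̄, z)·g(z) = Σ'_{w ∈ ℤ^d} T(x̂, w)·g(w̄)`. -/
theorem sum_periodise₂_mul {T : Kernel₂ d} (x : Site d s) (hT : Summable fun y => |T (windowMap d s x) y|) (g : Site d s → ℝ) :
    ∑ z : Site d s, periodise₂ s T x z * g z = ∑' w : Fin d → ℤ, T (windowMap d s x) w * g (siteOf d s w) := by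
  rw [tsum_eq_sum_tsum_imageShift (s := s) (summable_row_mul_torusFun hT g)]
  refine Finset.sum_congr rfl fun z _ => ?_
  simp only [siteOf_imageShift, siteOf_windowMap]
  rw [tsum_mul_right]
  rfl

/-- [folklore] For jointly `s`-periodic `T` and an `s·ℤ^d`-invariant weight `φ`, `Σ'_w T(r, w)·φ(w)` is representative-independent. -/
theorem tsum_row_mul_eq_of_rep {T : Kernel₂ d} (hper : IsPeriodic₂ s T) {r : Fin d → ℤ} {x : Site d s} (hr : siteOf d s r = x)
    (φ : (Fin d → ℤ) → ℝ) (hφ : ∀ w m, φ (imageShift s w m) = φ w) :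
    ∑' w, T r w * φ w = ∑' w, T (windowMap d s x) w * φ w := by
  obtain ⟨p, rfl⟩ := exists_eq_imageShift_of_siteOf_eq hr
  calc ∑' w, T (imageShift s (windowMap d s x) p) w * φ w
      = ∑' w, T (windowMap d s x) (imageShiftEquiv s (-p) w) * φ (imageShiftEquiv s (-p) w) :=
        tsum_congr fun w => by rw [imageShiftEquiv_apply, hper.shift_left, hφ]
    _ = ∑' w, T (windowMap d s x) w * φ w := (imageShiftEquiv s (-p)).tsum_eq (fun w => T (windowMap d s x) w * φ w)

/-- [folklore] **UNFOLD-AND-REGROUP (scalar, any representative `r` of `x̄`)**: `Σ_z T̂(x̄, z)·g(z) = Σ'_w T(r, w)·g(w̄)`. -/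
theorem sum_periodise₂_mul_of_rep {T : Kernel₂ d} (hper : IsPeriodic₂ s T) (hT : ∀ x, Summable fun y => |T x y|)
    {r : Fin d → ℤ} {x : Site d s} (hr : siteOf d s r = x) (g : Site d s → ℝ) :
    ∑ z : Site d s, periodise₂ s T x z * g z = ∑' w : Fin d → ℤ, T r w * g (siteOf d s w) := by
  rw [sum_periodise₂_mul x (hT _) g, tsum_row_mul_eq_of_rep hper hr (fun w => g (siteOf d s w))
    (fun w m => by rw [siteOf_imageShift])]

/-- [folklore] **UNFOLD-AND-REGROUP (fibred, window representative)** — the form brick Q4 consumes: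
`Σ_{(z̄,b)} K̂((x̄,a),(z̄,b))·g(z̄,b) = Σ_b Σ'_{w ∈ ℤ^d} K((x̂,a),(w,b))·g(w̄,b)`. -/
theorem sum_periodiseF_mul [Fintype β] {K : FKer d α β} (hK : ∀ a b x, Summable fun y => |Kfib K a b x y|)
    (g : Site d s × β → ℝ) (x : Site d s) (a : α) :
    ∑ j : Site d s × β, periodiseF s K (x, a) j * g j
      = ∑ b, ∑' w : Fin d → ℤ, K (windowMap d s x, a) (w, b) * g (siteOf d s w, b) := by
  rw [Fintype.sum_prod_type, Finset.sum_comm]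
  exact Finset.sum_congr rfl fun b _ => sum_periodise₂_mul x (hK a b _) (fun z => g (z, b))

/-- [folklore] **UNFOLD-AND-REGROUP (fibred, any representative)**: every fibre jointly `s`-periodic. -/
theorem sum_periodiseF_mul_of_rep [Fintype β] {K : FKer d α β} (hper : ∀ a b, IsPeriodic₂ s (Kfib K a b))
    (hK : ∀ a b x, Summable fun y => |Kfib K a b x y|) (g : Site d s × β → ℝ) {r : Fin d → ℤ} {x : Site d s}
    (hr : siteOf d s r = x) (a : α) :
    ∑ j : Site d s × β, periodiseF s K (x, a) j * g j = ∑ b, ∑' w : Fin d → ℤ, K (r, a) (w, b) * g (siteOf d s w, b) := by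
  rw [Fintype.sum_prod_type, Finset.sum_comm]
  exact Finset.sum_congr rfl fun b _ => sum_periodise₂_mul_of_rep (hper a b) (hK a b) hr (fun z => g (z, b))

/-- [folklore] PRODUCT-INDEX READING: `β` finite, `β`-slices absolutely summable ⟹ summable on `X × β` with `Σ' = Σ_b Σ'_w`. -/
theorem tsum_prod_fintype_right {X : Type*} [Fintype β] {F : X × β → ℝ} (hF : ∀ b, Summable fun w => |F (w, b)|) :
    Summable F ∧ ∑' p, F p = ∑ b, ∑' w, F (w, b) := by
  have habs : Summable fun p : X × β => |F p| := by
    refine (summable_prod_of_nonneg fun p => abs_nonneg (F p)).mpr ⟨fun w => ?_, ?_⟩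
    · exact (hasSum_fintype _).summable
    · simp only [tsum_fintype]
      exact summable_sum fun b _ => hF b
  have hs : Summable F := habs.of_abs
  refine ⟨hs, ?_⟩
  rw [hs.tsum_prod, ← Summable.tsum_finsetSum fun b _ => (hF b).of_abs]
  exact tsum_congr fun w => tsum_fintype _

/-! ## §5 Transposition -/

/-- [folklore] **TRANSPOSE RULE**: for jointly `s`-periodic `K`, `(Kᵀ)^(x̄, ȳ) = K̂(ȳ, x̄)` (shift to the other variable, `n ↦ −n`). -/
theorem periodise₂_transpose {K : Kernel₂ d} (hper : IsPeriodic₂ s K) (x y : Site d s) :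
    periodise₂ s (fun p q => K q p) x y = periodise₂ s K y x := by
  unfold periodise₂
  calc ∑' n, K (imageShift s (windowMap d s y) n) (windowMap d s x)
      = ∑' n, K (windowMap d s y) (imageShift s (windowMap d s x) (Equiv.neg _ n)) :=
        tsum_congr fun n => by rw [hper.shift_left, Equiv.neg_apply]
    _ = ∑' n, K (windowMap d s y) (imageShift s (windowMap d s x) n) :=
        (Equiv.neg _).tsum_eq (fun n => K (windowMap d s y) (imageShift s (windowMap d s x) n))

/-- [folklore] The periodisation of a SYMMETRIC jointly periodic kernel is symmetric. -/
theorem periodise₂_symm_of_symm {K : Kernel₂ d} (hper : IsPeriodic₂ s K) (hK : ∀ p q, K p q = K q p) (x y : Site d s) :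
    periodise₂ s K x y = periodise₂ s K y x := by
  have e : (fun p q => K q p) = K := funext fun p => funext fun q => hK q p
  calc periodise₂ s K x y = periodise₂ s (fun p q => K q p) x y := by rw [e]
    _ = periodise₂ s K y x := periodise₂_transpose hper x y

/-- [folklore] Fibred transpose rule: `(Kᵀ)^((ȳ,b),(x̄,a)) = K̂((x̄,a),(ȳ,b))`. -/
theorem periodiseF_transpose {K : FKer d α β} (hper : ∀ a b, IsPeriodic₂ s (Kfib K a b)) (x y : Site d s) (a : α) (b : β) :
    periodiseF s (fun i j => K j i) (y, b) (x, a) = periodiseF s K (x, a) (y, b) :=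
  periodise₂_transpose (hper a b) y x

/-! ## §6 The fibred finite-range dictionary (brick Q2's tool) -/

/-- [folklore] **LIFT FORM, FIBRED**: a jointly `s`-periodic fibre of range `R` with summable rows reads on the torus as on `ℤ^d`
whenever `|v_i| + R < s` (an4's `periodise₂_siteOf_eq`). -/
theorem periodiseF_siteOf_eq {K : FKer d α β} {a : α} {b : β} {R : ℕ} (hper : IsPeriodic₂ s (Kfib K a b))
    (hrow : ∀ x, Summable (Kfib K a b x)) (hR : HasRange (Kfib K a b) R) (p v : Fin d → ℤ) (hv : ∀ i, |v i| + R < s) :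
    periodiseF s K (siteOf d s p, a) (siteOf d s (p + v), b) = K (p, a) (p + v, b) :=
  periodise₂_siteOf_eq hper hrow hR p v hv

end Periodise

/-! ## §7 Non-vacuity: the fibred Kronecker kernel is its own `compF`-inverse -/

/-- [folklore] `δ ∘ δ = δ` for the fibred Kronecker kernel (so `lemma222F`'s algebraic hypothesis is met by `T = S = δ`). -/
theorem compF_kdeltaF_kdeltaF [Fintype α] [DecidableEq α] :
    compF (kdeltaF : FKer d α α) (kdeltaF : FKer d α α) = kdeltaF := by
  funext i j
  obtain ⟨x, a⟩ := i
  obtain ⟨z, c⟩ := j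
  rw [compF_apply, kdeltaF]
  have hb : ∀ b, compKer (Kfib (kdeltaF (d := d)) a b) (Kfib kdeltaF b c) x z = if (x, a) = (z, c) ∧ a = b then 1 else 0 := by
    intro b
    simp only [compKer, Kfib_apply, kdeltaF]
    rw [tsum_eq_single x]
    · by_cases hab : a = b
      · subst hab; simp
      · simp [hab]
    · intro y hy
      simp [Ne.symm hy]
  simp only [hb]
  by_cases h : (x, a) = (z, c)
  · simp [h]
  · simp [h]

end Summit.QuantumFields.BalabanUV.Beta.D1BFx.FibredPeriodisation

end
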